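import Summits.ValiantsHypothesis.ValiantsHypothesis.Theorems.DivisionGapPerDivisionHardStubPairFlipPens
import Summits.ValiantsHypothesis.ValiantsHypothesis.Theorems.DivisionGapPerDivisionHardStubAtomicTop

/-!
# Crux `DivisionGap.PerDivisionHard` (stmt-ValiantsHypothesis-5065), line `pair-descent-jss-endpoint` —
stub `stub_pairFlip`: K2 for sums of two binomial-atomic products, by flipping one atom

`stub_pairFlip` (skeleton v7.2, dossier v4 §3): at a face `G` containing a perfect matching, an
expression `h = Σ_{l ∈ L} a_l · x^{C_l} · ∏_{β ∈ I} F_β^{μ_l β}` with `|L| ≤ 2` over atoms with at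
most two monomials (of equal degree within the atom), all monomials of `h` of equal degree, every
binomial atom's monomials differing off `G` (H1), two terms `l₁ ≠ l₂` separated by a binomial atom
`β₀` with monomials `s ≠ s'` and cells `ep, em ∉ G` where `s − s'` is positive resp. negative, and
every other binomial atom non-parallel to `s − s'` off `G` (H2), admits a weight cutting out `G`
with a single `G`-part.

Proof (three-level penalties).  `g` = place values off `G` in a radix `B` exceeding all relevant
entries; `q₁ = cc·g + αc·𝟙_{ep} + βc·𝟙_{em}` with `cc = dp·dm`, `αc = dm·t⁻`, `βc = dp·t⁺`
(`dp = s ep − s' ep`, `dm = s' em − s em`, `t = g·s − g·s'`) is INDIFFERENT on `β₀`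
(`q₁·s = q₁·s'`) and decides every other binomial atom STRICTLY (an equality `q₁·f = q₁·f'` is a
relation `k(g·f − g·f') + c(g·s − g·s') = 0`, which by digit uniqueness makes `k(f − f') + c(s − s')`
vanish off `G`, excluded by H2).  The penalties `q^± = M²·q₁ + M·𝟙_{e^±} + g` then decide `β₀`
oppositely and every other atom identically (dominance), so the two top fibres consist of the
candidate monomials `A^±_l = C_l + Σ_β μ_l β · b^±_β` with `A⁺_l − A⁻_l = μ_l β₀ · (s' − s)`.  A
fibre with two `G`-parts has `A^±_{l₁} ≡ A^±_{l₂}` off `G` (equal penalty, dominance, digits); both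
fibres bad would give `(μ_{l₁} β₀ − μ_{l₂} β₀)(s' − s) ≡ 0` off `G`, contradicting H1 at `β₀`.
-/

noncomputable section

-- `Summit.ValiantsHypothesis.ValiantsHypothesis.…` is the tree's mandated single-conjunct layout
-- (Sub = Summit), so the duplicated namespace component is intended.
set_option linter.dupNamespace false

namespace Summit.ValiantsHypothesis.ValiantsHypothesis.Theorems.DivisionGapPerDivisionHard

open MvPolynomial Literature.Computability.AlgebraicComplexity
open Summit.ValiantsHypothesis.ValiantsHypothesis.Theorems.ZeroOneTransfer.Negative
open scoped NNReal

/-- **`stub_pairFlip`** (skeleton v7.2 of line `pair-descent-jss-endpoint`): K2 at a face for an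
expression with at most two terms over binomial atoms, by flipping one separating atom between two
three-level penalty weights — see the module docstring. [folklore] -/
theorem stub_pairFlip :
    ∀ (n : ℕ) (G : Finset (Fin n × Fin n)) (ι κ : Type) (I : Finset ι) (L : Finset κ)
      (F : ι → MvPolynomial (Fin n × Fin n) ℝ≥0) (a : κ → ℝ≥0) (C : κ → (Fin n × Fin n) →₀ ℕ)
      (μ : κ → ι → ℕ) (l₁ l₂ : κ) (β₀ : ι) (s s' : (Fin n × Fin n) →₀ ℕ) (ep em : Fin n × Fin n),
      (∃ σ : Equiv.Perm (Fin n), ∀ i, (σ i, i) ∈ G) →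
      (∀ β ∈ I, F β ≠ 0 ∧ (F β).support.card ≤ 2 ∧
        ∀ f ∈ (F β).support, ∀ f' ∈ (F β).support, f.degree = f'.degree) →
      L.card ≤ 2 → (∀ l ∈ L, a l ≠ 0) →
      (∀ m₁ ∈ (∑ l ∈ L, a l • (monomial (C l) (1 : ℝ≥0) * ∏ β ∈ I, F β ^ μ l β)).support,
        ∀ m₂ ∈ (∑ l ∈ L, a l • (monomial (C l) (1 : ℝ≥0) * ∏ β ∈ I, F β ^ μ l β)).support,
        m₁.degree = m₂.degree) →
      (∀ β ∈ I, ∀ f ∈ (F β).support, ∀ f' ∈ (F β).support, f ≠ f' → ∃ e ∉ G, f e ≠ f' e) →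
      l₁ ∈ L → l₂ ∈ L → l₁ ≠ l₂ → β₀ ∈ I → μ l₁ β₀ ≠ μ l₂ β₀ →
      s ∈ (F β₀).support → s' ∈ (F β₀).support → s ≠ s' →
      ep ∉ G → em ∉ G → s' ep < s ep → s em < s' em →
      (∀ β ∈ I, β ≠ β₀ → ∀ f ∈ (F β).support, ∀ f' ∈ (F β).support, f ≠ f' →
        ∀ i j : ℤ, (i ≠ 0 ∨ j ≠ 0) →
          ∃ e ∉ G, i * ((f e : ℤ) - f' e) ≠ j * ((s e : ℤ) - s' e)) →
      ∃ w : Fin n × Fin n → ℕ, CutsOut w G ∧ ∃ u : (Fin n × Fin n) →₀ ℕ,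
        HasSingleGPart G w (∑ l ∈ L, a l • (monomial (C l) (1 : ℝ≥0) * ∏ β ∈ I, F β ^ μ l β)) u := by
  intro n G ι κ I L F a C μ l₁ l₂ β₀ s s' ep em hPM hF hL _ha hdegh H1 hl₁ hl₂ hl₁₂ hβ₀ hμ hs hs'
    hss' hep hem hsep hsem H2
  classical
  obtain ⟨h, hhdef⟩ : ∃ h : MvPolynomial (Fin n × Fin n) ℝ≥0,
      h = ∑ l ∈ L, a l • (monomial (C l) (1 : ℝ≥0) * ∏ β ∈ I, F β ^ μ l β) := ⟨_, rfl⟩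
  rw [← hhdef] at hdegh ⊢
  /- ### bounds -/
  obtain ⟨D, hD⟩ : ∃ D : ℕ, D = h.totalDegree + ∑ β ∈ I, (F β).totalDegree := ⟨_, rfl⟩
  have hatomD : ∀ β ∈ I, ∀ f ∈ (F β).support, ∀ e, f e ≤ D := by
    intro β hβ f hf e
    calc f e ≤ f.degree := Finsupp.le_degree e f
      _ ≤ (F β).totalDegree := le_totalDegree hf
      _ ≤ ∑ β ∈ I, (F β).totalDegree :=
          Finset.single_le_sum (f := fun β => (F β).totalDegree) (fun _ _ => Nat.zero_le _) hβ
      _ ≤ D := by rw [hD]; exact Nat.le_add_left _ _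
  have hatomDeg : ∀ β ∈ I, ∀ f ∈ (F β).support, f.degree ≤ D := by
    intro β hβ f hf
    calc f.degree ≤ (F β).totalDegree := le_totalDegree hf
      _ ≤ ∑ β ∈ I, (F β).totalDegree :=
          Finset.single_le_sum (f := fun β => (F β).totalDegree) (fun _ _ => Nat.zero_le _) hβ
      _ ≤ D := by rw [hD]; exact Nat.le_add_left _ _
  have hmonoD : ∀ m ∈ h.support, ∀ e, m e ≤ D := fun m hm e =>
    le_trans (Finsupp.le_degree e m) (le_trans (le_totalDegree hm) (by rw [hD]; exact Nat.le_add_right _ _))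
  have hmonoDeg : ∀ m ∈ h.support, m.degree ≤ D := fun m hm =>
    le_trans (le_totalDegree hm) (by rw [hD]; exact Nat.le_add_right _ _)
  -- radix and place values
  obtain ⟨B, hB⟩ : ∃ B : ℕ, B = 3 * (D * D) + D + 1 := ⟨_, rfl⟩
  obtain ⟨g, hgdef⟩ : ∃ g : Fin n × Fin n → ℕ,
      g = fun e => if e ∈ G then 0 else B ^ (finProdFinEquiv e : ℕ) := ⟨_, rfl⟩
  /- ### the penalties -/
  obtain ⟨q₁, Q₁, hq₁le, hq₁G, hindiff, hstrict⟩ := PairFlip.exists_indiffPen G I F β₀ s s' ep em g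
    hgdef hB hatomD hatomDeg hβ₀ hs hs' hep hem hsep hsem H2
  obtain ⟨qp, qm, W, hcutp, hcutm, hWp, hWm, hdec₀p, hdec₀m, hdec, hgen⟩ :=
    PairFlip.exists_flipPens G hPM s s' ep em g hgdef hB (hatomDeg β₀ hβ₀ s hs)
      (hatomDeg β₀ hβ₀ s' hs') hep hem hsep hsem q₁ Q₁ hq₁le hq₁G hindiff
  /- ### the decided monomials `bsel`, `bp`, `bm` and the atoms' top fibres -/
  have hbsel : ∀ β ∈ I, ∃ f ∈ (F β).support, ∀ d ∈ (F β).support, (∑ e, q₁ e * f e) ≤ ∑ e, q₁ e * d e :=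
    fun β hβ => Finset.exists_min_image _ (fun f => ∑ e, q₁ e * f e) (support_nonempty.mpr (hF β hβ).1)
  choose! bsel hbselmem hbselmin using hbsel
  obtain ⟨bp, hbpdef⟩ : ∃ bp : ι → (Fin n × Fin n) →₀ ℕ,
      bp = fun β => if β = β₀ then s' else bsel β := ⟨_, rfl⟩
  obtain ⟨bm, hbmdef⟩ : ∃ bm : ι → (Fin n × Fin n) →₀ ℕ,
      bm = fun β => if β = β₀ then s else bsel β := ⟨_, rfl⟩
  -- support of an atom with two named monomials
  have hsupp₀ : ∀ d ∈ (F β₀).support, d ≠ s' → d = s := by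
    intro d hd hds'
    by_contra hds
    have h3 : ({s, s', d} : Finset _) ⊆ (F β₀).support := by
      intro x hx
      simp only [Finset.mem_insert, Finset.mem_singleton] at hx
      rcases hx with rfl | rfl | rfl <;> assumption
    have hc3 : ({s, s', d} : Finset ((Fin n × Fin n) →₀ ℕ)).card = 3 := by
      rw [Finset.card_insert_of_notMem, Finset.card_pair (Ne.symm hds')]
      simp only [Finset.mem_insert, Finset.mem_singleton, not_or]
      exact ⟨hss', Ne.symm hds⟩
    have := Finset.card_le_card h3
    have := (hF β₀ hβ₀).2.1
    omega
  have hsupp₀' : ∀ d ∈ (F β₀).support, d ≠ s → d = s' := fun d hd hds => by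
    by_contra h'; exact hds (hsupp₀ d hd h')
  have htopp : ∀ β ∈ I, (topComponent (fun e => W - qp e) (F β)).support = {bp β} := by
    intro β hβ
    by_cases hβe : β = β₀
    · subst hβe
      have : bp β = s' := by simp [hbpdef]
      rw [this]
      refine PairFlip.support_topComponent_eq_singleton_of_pen_lt qp hWp hs'
        (fun d hd => (hF β hβ).2.2 d hd s' hs') fun d hd hds' => ?_
      rw [hsupp₀ d hd hds']; exact hdec₀p
    · have : bp β = bsel β := by simp [hbpdef, hβe]
      rw [this]
      refine PairFlip.support_topComponent_eq_singleton_of_pen_lt qp hWp (hbselmem β hβ)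
        (fun d hd => (hF β hβ).2.2 d hd _ (hbselmem β hβ)) fun d hd hdf => ?_
      have hle := hbselmin β hβ d hd
      have hne := hstrict β hβ hβe (bsel β) (hbselmem β hβ) d hd (Ne.symm hdf)
      exact (hdec (bsel β) d (hatomD β hβ _ (hbselmem β hβ)) (hatomD β hβ d hd)
        (hatomDeg β hβ _ (hbselmem β hβ)) (hatomDeg β hβ d hd)
        (lt_of_le_of_ne hle fun h' => hne (by exact_mod_cast h'))).1
  have htopm : ∀ β ∈ I, (topComponent (fun e => W - qm e) (F β)).support = {bm β} := by
    intro β hβ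
    by_cases hβe : β = β₀
    · subst hβe
      have : bm β = s := by simp [hbmdef]
      rw [this]
      refine PairFlip.support_topComponent_eq_singleton_of_pen_lt qm hWm hs
        (fun d hd => (hF β hβ).2.2 d hd s hs) fun d hd hds => ?_
      rw [hsupp₀' d hd hds]; exact hdec₀m
    · have : bm β = bsel β := by simp [hbmdef, hβe]
      rw [this]
      refine PairFlip.support_topComponent_eq_singleton_of_pen_lt qm hWm (hbselmem β hβ)
        (fun d hd => (hF β hβ).2.2 d hd _ (hbselmem β hβ)) fun d hd hdf => ?_
      have hle := hbselmin β hβ d hd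
      have hne := hstrict β hβ hβe (bsel β) (hbselmem β hβ) d hd (Ne.symm hdf)
      exact (hdec (bsel β) d (hatomD β hβ _ (hbselmem β hβ)) (hatomD β hβ d hd)
        (hatomDeg β hβ _ (hbselmem β hβ)) (hatomDeg β hβ d hd)
        (lt_of_le_of_ne hle fun h' => hne (by exact_mod_cast h'))).2
  /- ### the fibres: every top monomial is a candidate `A l` -/
  obtain ⟨Ap, hApdef⟩ : ∃ Ap : κ → (Fin n × Fin n) →₀ ℕ,
      Ap = fun l => C l + ∑ β ∈ I, μ l β • bp β := ⟨_, rfl⟩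
  obtain ⟨Am, hAmdef⟩ : ∃ Am : κ → (Fin n × Fin n) →₀ ℕ,
      Am = fun l => C l + ∑ β ∈ I, μ l β • bm β := ⟨_, rfl⟩
  have hfibp : ∀ m ∈ (topComponent (fun e => W - qp e) h).support, ∃ l ∈ L, m = Ap l := by
    intro m hm
    rw [hhdef] at hm
    obtain ⟨l, hl, fsel, hfsel, rfl⟩ := stub_atomicTop n ι κ I L F a C μ _ m hm
    refine ⟨l, hl, ?_⟩
    rw [hApdef]
    show C l + ∑ β ∈ I, ∑ j ∈ Finset.range (μ l β), fsel β j = C l + ∑ β ∈ I, μ l β • bp β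
    congr 1
    refine Finset.sum_congr rfl fun β hβ => ?_
    have hall : ∀ j ∈ Finset.range (μ l β), fsel β j = bp β := fun j hj => by
      have := hfsel β hβ j (Finset.mem_range.mp hj)
      rw [htopp β hβ] at this
      exact Finset.mem_singleton.mp this
    rw [Finset.sum_congr rfl hall, Finset.sum_const, Finset.card_range]
  have hfibm : ∀ m ∈ (topComponent (fun e => W - qm e) h).support, ∃ l ∈ L, m = Am l := by
    intro m hm
    rw [hhdef] at hm
    obtain ⟨l, hl, fsel, hfsel, rfl⟩ := stub_atomicTop n ι κ I L F a C μ _ m hm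
    refine ⟨l, hl, ?_⟩
    rw [hAmdef]
    show C l + ∑ β ∈ I, ∑ j ∈ Finset.range (μ l β), fsel β j = C l + ∑ β ∈ I, μ l β • bm β
    congr 1
    refine Finset.sum_congr rfl fun β hβ => ?_
    have hall : ∀ j ∈ Finset.range (μ l β), fsel β j = bm β := fun j hj => by
      have := hfsel β hβ j (Finset.mem_range.mp hj)
      rw [htopm β hβ] at this
      exact Finset.mem_singleton.mp this
    rw [Finset.sum_congr rfl hall, Finset.sum_const, Finset.card_range]
  -- the flip: `Ap l - Am l = μ l β₀ • (s' - s)`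
  have hbp₀ : bp β₀ = s' := by rw [hbpdef]; exact if_pos rfl
  have hbm₀ : bm β₀ = s := by rw [hbmdef]; exact if_pos rfl
  have hbpm : ∀ β, β ≠ β₀ → bp β = bm β := fun β hne => by
    rw [hbpdef, hbmdef]; simp only [if_neg hne]
  have hflip : ∀ l e, (Ap l e : ℤ) - Am l e = μ l β₀ * ((s' e : ℤ) - s e) := by
    intro l e
    rw [hApdef, hAmdef]
    simp only [Finsupp.add_apply, Finsupp.coe_finsetSum, Finset.sum_apply,
      Finsupp.smul_apply, smul_eq_mul]
    push_cast
    rw [add_sub_add_left_eq_sub, ← Finset.sum_sub_distrib]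
    rw [Finset.sum_eq_single_of_mem β₀ hβ₀ fun β _ hβne => ?_]
    · rw [hbp₀, hbm₀]; ring
    · rw [hbpm β hβne]; ring
  /- ### good fibres -/
  have hgood : ∀ (q : Fin n × Fin n → ℕ), CutsOut (fun e => W - q e) G →
      (∀ m₁ ∈ (topComponent (fun e => W - q e) h).support,
        ∀ m₂ ∈ (topComponent (fun e => W - q e) h).support, ∀ e ∈ G, m₁ e = m₂ e) →
      ∃ w : Fin n × Fin n → ℕ, CutsOut w G ∧ ∃ u : (Fin n × Fin n) →₀ ℕ, HasSingleGPart G w h u := by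
    intro q hcut hagree
    refine ⟨_, hcut, ?_⟩
    by_cases h0 : h = 0
    · refine ⟨0, by simp, fun m hm => ?_⟩
      rw [h0, topComponent_zero] at hm
      simp at hm
    · obtain ⟨m₀, hm₀⟩ := support_nonempty.mpr (topComponent_ne_zero (fun e => W - q e) h0)
      refine ⟨m₀.filter (· ∈ G), fun e he => ?_, fun m' hm' e he => ?_⟩
      · rw [Finsupp.support_filter] at he
        exact (Finset.mem_filter.mp he).2
      · rw [Finsupp.filter_apply_pos _ _ he, hagree m' hm' m₀ hm₀ e he]
  /- ### case analysis: not both fibres can be bad -/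
  by_cases hbadp : ∀ m₁ ∈ (topComponent (fun e => W - qp e) h).support,
      ∀ m₂ ∈ (topComponent (fun e => W - qp e) h).support, ∀ e ∈ G, m₁ e = m₂ e
  · exact hgood qp hcutp hbadp
  by_cases hbadm : ∀ m₁ ∈ (topComponent (fun e => W - qm e) h).support,
      ∀ m₂ ∈ (topComponent (fun e => W - qm e) h).support, ∀ e ∈ G, m₁ e = m₂ e
  · exact hgood qm hcutm hbadm
  exfalso
  push Not at hbadp hbadm
  -- from a bad `qp`-fibre: `Ap l₁ ≡ Ap l₂` off `G`
  have hAp : ∀ e ∉ G, Ap l₁ e = Ap l₂ e := by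
    obtain ⟨m₁, hm₁, m₂, hm₂, e₀, he₀, hne⟩ := hbadp
    have hmne : m₁ ≠ m₂ := fun h' => hne (by rw [h'])
    obtain ⟨x, hx, rfl⟩ := hfibp m₁ hm₁
    obtain ⟨y, hy, rfl⟩ := hfibp m₂ hm₂
    have hxy : x ≠ y := fun h' => hmne (by rw [h'])
    have hs₁ := support_topComponent_subset _ h hm₁
    have hs₂ := support_topComponent_subset _ h hm₂
    have hpeneq := PairFlip.pen_eq_of_mem_support_topComponent qp hWp hm₁ hm₂ (hdegh _ hs₁ _ hs₂)
    have hag := (hgen _ _ (hmonoD _ hs₁) (hmonoD _ hs₂) (hmonoDeg _ hs₁) (hmonoDeg _ hs₂)).1 hpeneq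
    rcases PairFlip.pair_cases hL hl₁ hl₂ hl₁₂ hx hy hxy with ⟨rfl, rfl⟩ | ⟨rfl, rfl⟩
    · exact hag
    · exact fun e he => (hag e he).symm
  have hAm : ∀ e ∉ G, Am l₁ e = Am l₂ e := by
    obtain ⟨m₁, hm₁, m₂, hm₂, e₀, he₀, hne⟩ := hbadm
    have hmne : m₁ ≠ m₂ := fun h' => hne (by rw [h'])
    obtain ⟨x, hx, rfl⟩ := hfibm m₁ hm₁
    obtain ⟨y, hy, rfl⟩ := hfibm m₂ hm₂
    have hxy : x ≠ y := fun h' => hmne (by rw [h'])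
    have hs₁ := support_topComponent_subset _ h hm₁
    have hs₂ := support_topComponent_subset _ h hm₂
    have hpeneq := PairFlip.pen_eq_of_mem_support_topComponent qm hWm hm₁ hm₂ (hdegh _ hs₁ _ hs₂)
    have hag := (hgen _ _ (hmonoD _ hs₁) (hmonoD _ hs₂) (hmonoDeg _ hs₁) (hmonoDeg _ hs₂)).2 hpeneq
    rcases PairFlip.pair_cases hL hl₁ hl₂ hl₁₂ hx hy hxy with ⟨rfl, rfl⟩ | ⟨rfl, rfl⟩
    · exact hag
    · exact fun e he => (hag e he).symm
  -- hence `s ≡ s'` off `G`, contradicting (H1) at `β₀`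
  obtain ⟨e, heG, hne⟩ := H1 β₀ hβ₀ s hs s' hs' hss'
  have h1 := hflip l₁ e
  have h2 := hflip l₂ e
  have h3 : (Ap l₁ e : ℤ) = Ap l₂ e := by exact_mod_cast hAp e heG
  have h4 : (Am l₁ e : ℤ) = Am l₂ e := by exact_mod_cast hAm e heG
  have hμ' : ((μ l₁ β₀ : ℤ) - μ l₂ β₀) ≠ 0 := by
    intro h0; apply hμ; exact_mod_cast (sub_eq_zero.mp h0)
  have key : ((μ l₁ β₀ : ℤ) - μ l₂ β₀) * ((s' e : ℤ) - s e) = 0 := by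
    linear_combination -h1 + h2 + h3 - h4
  rcases mul_eq_zero.mp key with h0 | h0
  · exact hμ' h0
  · exact hne (by exact_mod_cast (sub_eq_zero.mp h0).symm)

end Summit.ValiantsHypothesis.ValiantsHypothesis.Theorems.DivisionGapPerDivisionHard

end
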